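import Summits.CriticalPhenomena.CardyFormulaZ2.Theorems.CardyFlipRussoCoveringLegTwins
import HarnessLib

/-!
# The wide-collar covering bridge `B'` (line `five-arm-null`, lead c4, cycle 5): the Union-Jack route's crude
`P_{1/2,0}` crossing probabilities ARE the crude bond-`ℤ²` crossing probabilities up to `o(1)`

Route `CardyFlipRusso`, sub-problem `CriticalPhenomena/CardyFormulaZ2`, crux item stmt-CriticalPhenomena-6435
(`CardyFlipRusso.CoveringLeg`).  The twins file (`…CoveringLegTwins.lean`, p136569) shows that the one open stub of the
line is `UnionJackBeffara.MixedInterpolation` (stmt-CriticalPhenomena-4559) modulo two discretisation nulls, `T'` (site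
side) and `B'` (bond side).  This file PROVES `B'`:

* `wide_tendsto_sub` — for every conformal rectangle `R`,
  `ujCrossingProb 0 R (√2·δ) − bondProb R δ → 0` as `δ → 0⁺`: Kesten's covering encoding of bond-`ℤ²` in the Union-Jack
  frame (mesh `√2·δ`, i.e. frame B at mesh `δ` with the WIDE endpoint slack `2√2·δ`, `ujCrossingProb_sqrt_two_mul`) and
  the tree's crude bond event `embDomainCrossing squareLatticeEmbedding.z` (edge `√2·δ`, slack `2δ`) have asymptotically
  equal `P_{1/2}`-probabilities.  Same collar squeeze as the landed `coverShift_tendsto_sub` (c1, p122240): at fixed mesh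
  `lowerCrossing R κ ρ δ ⊆ coverMap ⁻¹ W ⊆ upperCrossing R ρ δ` (now `4δ ≤ ρ`: the wide slack costs one more `δ`, routed
  through the `δ`-thickened arcs so that direction A of the covering dictionary, `cover_preimage_siteCross_subset`, is
  reused verbatim), Kesten's coupling `P_{1/2,0} = coverMap_* P^{bond}_{1/2}`, and the tree's PROVED mesh-uniform
  crude-crossing continuity for bond-`ℤ²` (`stub_CrudeCrossingContinuity_of_SS` ∘ `SchrammSmirnov2011_lemma_5_1_holds`).
* `stub_iff_unionJackBeffara_of_siteNull`, `coveringLeg_of_unionJackBeffara_of_siteNull` — hence the stub (and, by the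
  landed skeleton, the crux) IS stmt-4559 modulo the SINGLE site-side null `T'`
  (`ujCrossingProb ½ R (√2·δ) − siteProb (ρ⁻¹R) δ → 0`: boundary RSW for critical site percolation on `G_s`, not in
  the tree).
* `unionJackBeffara_coveringBridge_of_discretisationBridge` — a by-product for route UnionJackBeffara: its crux
  `CoveringBridge` (stmt-CriticalPhenomena-4560) FOLLOWS from the shared support item `DiscretisationBridge`
  (stmt-CriticalPhenomena-0787, stated in this route's file as `CardyFlipRusso.DiscretisationBridge`) by `wide_tendsto_sub`.

References: H. Kesten, *Percolation theory for mathematicians* (1982) §3.4 [Kesten1982]; V. Beffara, *Is critical 2D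
percolation universal?*, Progr. Probab. 60 (2008) §5.1 [Beffara2008Universal]; O. Schramm, S. Smirnov, Ann. Probab. 39
(2011) Lemma 5.1 [SchrammSmirnov2011].
-/

noncomputable section

namespace Summit.CriticalPhenomena.CardyFormulaZ2.Cruxes.CoveringLeg.FiveArmNull

open MeasureTheory Filter Set Topology
open Literature.Probability.RandomPlanarGeometry Literature.Probability.Percolation
open Literature.Probability.LatticeModels
open Literature.Barriers.CriticalPhenomena (MixedSite mixedParam)
open Summit.CriticalPhenomena.CardyFormulaZ2.Theses
open Summit.CriticalPhenomena.CardyFormulaZ2.Theorems.CornerLineDescent.SymmetricSeed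

/-! ### Metric bookkeeping -/

/-- A point of the open `r`-thickening of `A` is within `r` of `A`. [folklore] -/
theorem wide_infDist_le_of_mem_thickening {p : ℂ} {A : Set ℂ} {r : ℝ} (h : p ∈ Metric.thickening r A) :
    Metric.infDist p A ≤ r := by
  obtain ⟨a, ha, hpa⟩ := Metric.mem_thickening_iff.1 h
  exact (Metric.infDist_le_dist_of_mem ha).trans hpa.le

/-- `infDist p A ≤ infDist p (thickening r A) + r` for `r > 0`. [folklore] -/
theorem wide_infDist_le_infDist_thickening_add {p : ℂ} {A : Set ℂ} {r : ℝ} (hr : 0 < r) :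
    Metric.infDist p A ≤ Metric.infDist p (Metric.thickening r A) + r := by
  rcases A.eq_empty_or_nonempty with rfl | hA
  · simp only [Metric.thickening_empty, Metric.infDist_empty, zero_add]
    exact hr.le
  have hT : (Metric.thickening r A).Nonempty := hA.mono (Metric.self_subset_thickening hr A)
  refine le_of_forall_pos_lt_add fun ε hε => ?_
  obtain ⟨q, hq, hpq⟩ := (Metric.infDist_lt_iff hT).1
    (lt_add_of_pos_right (Metric.infDist p (Metric.thickening r A)) hε)
  obtain ⟨a, ha, hqa⟩ := Metric.mem_thickening_iff.1 hq
  calc Metric.infDist p A ≤ dist p a := Metric.infDist_le_dist_of_mem ha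
    _ ≤ dist p q + dist q a := dist_triangle _ _ _
    _ < Metric.infDist p (Metric.thickening r A) + ε + r := add_lt_add hpq hqa
    _ = Metric.infDist p (Metric.thickening r A) + r + ε := by ring

/-- `2√2·δ ≤ 3δ` for `δ ≥ 0` (`√2 ≤ 3/2`). [folklore] -/
theorem wide_slack_le_three {δ : ℝ} (hδ : 0 ≤ δ) : 2 * Real.sqrt 2 * δ ≤ 3 * δ := by
  have h : Real.sqrt 2 ≤ 3 / 2 := by
    rw [show (3 / 2 : ℝ) = Real.sqrt ((3 / 2) ^ 2) from (Real.sqrt_sq (by norm_num)).symm]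
    exact Real.sqrt_le_sqrt (by norm_num)
  nlinarith

/-- `2δ ≤ 2√2·δ` for `δ ≥ 0` (`1 ≤ √2`). [folklore] -/
theorem wide_two_mul_le_slack {δ : ℝ} (hδ : 0 ≤ δ) : 2 * δ ≤ 2 * Real.sqrt 2 * δ := by
  have h : (1 : ℝ) ≤ Real.sqrt 2 := Real.one_le_sqrt.2 one_le_two
  nlinarith

/-! ### The wide event and its two inclusions at fixed mesh -/

/-- **The wide frame-B crude event is inside the standard crude event of the `δ`-thickened arcs**: a site within
`2√2·δ ≤ 3δ` of an arc is within `2δ` of its `δ`-thickening (`cover_infDist_thickening_le`).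
[cite: Beffara2008Universal, §5.1] -/
theorem wide_subset_siteCross_thickening (R : ConformalRectangle) {δ : ℝ} (hδ : 0 < δ) :
    {ω : Set MixedSite | ∃ u v, Metric.infDist ((δ : ℂ) * zS u) (R.arc 0) ≤ 2 * Real.sqrt 2 * δ ∧
        Metric.infDist ((δ : ℂ) * zS v) (R.arc 2) ≤ 2 * Real.sqrt 2 * δ ∧
        ω ∈ siteConnIn gsGraph {y | (δ : ℂ) * zS y ∈ R.carrier} u v} ⊆
      siteEmbDomainCrossing centredSquareGraph coverZ R.carrier δ
        (Metric.thickening δ (R.arc 0)) (Metric.thickening δ (R.arc 2)) := by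
  rintro ω ⟨u, v, hu, hv, hω⟩
  rw [gsGraph_eq] at hω
  have h3 : ∀ {p : ℂ} {A : Set ℂ}, Metric.infDist p A ≤ 2 * Real.sqrt 2 * δ →
      Metric.infDist p (Metric.thickening δ A) ≤ 2 * δ :=
    fun h => cover_infDist_thickening_le hδ (h.trans (wide_slack_le_three hδ.le))
  exact ⟨u, v, h3 hu, h3 hv, hω⟩

/-- **Upper inclusion** (`4δ ≤ ρ`): the covering preimage of the wide event lies in the fattened bond event
`upperCrossing R ρ δ` — direction A of the covering dictionary applied to the thickened arcs puts an open bond path in the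
`δ`-thickening of `Ω` with ends within `3δ` of the thickened arcs, i.e. within `4δ` of the arcs. [cite: Kesten1982, §3.4] -/
theorem wide_preimage_subset_upper (R : ConformalRectangle) {δ ρ : ℝ} (hδ : 0 < δ) (hρ : 4 * δ ≤ ρ) :
    coverMap ⁻¹' {ω : Set MixedSite | ∃ u v, Metric.infDist ((δ : ℂ) * zS u) (R.arc 0) ≤ 2 * Real.sqrt 2 * δ ∧
        Metric.infDist ((δ : ℂ) * zS v) (R.arc 2) ≤ 2 * Real.sqrt 2 * δ ∧
        ω ∈ siteConnIn gsGraph {y | (δ : ℂ) * zS y ∈ R.carrier} u v} ⊆ Freeze.upperCrossing R ρ δ := by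
  refine (Set.preimage_mono (wide_subset_siteCross_thickening R hδ)).trans
    ((cover_preimage_siteCross_subset _ _ _ hδ).trans (cover_openCrossing_mono ?_ ?_ ?_))
  · intro y hy
    simp only [Set.mem_setOf_eq] at hy ⊢
    have h := wide_infDist_le_of_mem_thickening hy
    linarith
  · intro u hu
    simp only [Set.mem_setOf_eq] at hu ⊢
    have h := wide_infDist_le_infDist_thickening_add
      (p := (δ : ℂ) * squareLatticeEmbedding.z u) (A := R.arc 0) hδ
    linarith
  · intro v hv
    simp only [Set.mem_setOf_eq] at hv ⊢
    have h := wide_infDist_le_infDist_thickening_add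
      (p := (δ : ℂ) * squareLatticeEmbedding.z v) (A := R.arc 2) hδ
    linarith

/-- **Lower inclusion** (`δ ≤ κ`, `δ ≤ ρ`; on the a.s. event `η ⊆ E(ℤ²)`): the thinned collar-to-collar bond crossing
forces the wide site event in the covering configuration — it forces the standard one (`cover_lowerCrossing_subset_crossS_shift`
at `w = 0`, landed p121761), and the wide event only relaxes the endpoint slack (`2δ ≤ 2√2·δ`). [cite: Kesten1982, §3.4] -/
theorem wide_lowerCrossing_subset_preimage (R : ConformalRectangle) {κ ρ δ : ℝ} (hδ : 0 < δ) (hδκ : δ ≤ κ)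
    (hδρ : δ ≤ ρ) {η : Set (Sym2 (Site 2))} (hη : η ⊆ (zdGraph 2).edgeSet)
    (hL : η ∈ Freeze.lowerCrossing R κ ρ δ) :
    coverMap η ∈ {ω : Set MixedSite | ∃ u v, Metric.infDist ((δ : ℂ) * zS u) (R.arc 0) ≤ 2 * Real.sqrt 2 * δ ∧
        Metric.infDist ((δ : ℂ) * zS v) (R.arc 2) ≤ 2 * Real.sqrt 2 * δ ∧
        ω ∈ siteConnIn gsGraph {y | (δ : ℂ) * zS y ∈ R.carrier} u v} := by
  have h1 : δ * (‖(0 : ℂ)‖ + 1) ≤ ρ := by simpa using hδρ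
  have h := cover_lowerCrossing_subset_crossS_shift R 0 κ ρ δ hδ hδκ h1 η hη hL
  rw [mul_zero, map_similarity_one_zero] at h
  obtain ⟨u, v, hu, hv, hω⟩ := h
  exact ⟨u, v, hu.trans (wide_two_mul_le_slack hδ.le), hv.trans (wide_two_mul_le_slack hδ.le), hω⟩

/-! ### Measurability of the wide event (it is the Union-Jack crude event at mesh `√2·δ`) -/

/-- The wide frame-B event at mesh `δ` IS the Union-Jack crude crossing event at mesh `√2·δ` (as a set).
[cite: Beffara2008Universal, §5.1] -/
theorem wide_eq_siteEmbDomainCrossing (R : ConformalRectangle) (δ : ℝ) :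
    {ω : Set MixedSite | ∃ u v, Metric.infDist ((δ : ℂ) * zS u) (R.arc 0) ≤ 2 * Real.sqrt 2 * δ ∧
        Metric.infDist ((δ : ℂ) * zS v) (R.arc 2) ≤ 2 * Real.sqrt 2 * δ ∧
        ω ∈ siteConnIn gsGraph {y | (δ : ℂ) * zS y ∈ R.carrier} u v} =
      siteEmbDomainCrossing unionJackGraph unionJackEmbed R.carrier (Real.sqrt 2 * δ) (R.arc 0) (R.arc 2) := by
  have hsl : 2 * (Real.sqrt 2 * δ) = 2 * Real.sqrt 2 * δ := by ring
  ext ω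
  simp only [mem_siteEmbDomainCrossing_iff, Set.mem_setOf_eq, sqrt_two_mul_mul_unionJackEmbed, hsl,
    unionJackGraph_eq_gsGraph]

/-- **The wide event is measurable** (`δ ≠ 0`): its window is the finite frame-B window. [folklore] -/
theorem wide_measurableSet (R : ConformalRectangle) {δ : ℝ} (hδ : δ ≠ 0) :
    MeasurableSet {ω : Set MixedSite | ∃ u v, Metric.infDist ((δ : ℂ) * zS u) (R.arc 0) ≤ 2 * Real.sqrt 2 * δ ∧
        Metric.infDist ((δ : ℂ) * zS v) (R.arc 2) ≤ 2 * Real.sqrt 2 * δ ∧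
        ω ∈ siteConnIn gsGraph {y | (δ : ℂ) * zS y ∈ R.carrier} u v} := by
  rw [wide_eq_siteEmbDomainCrossing]
  refine cover_measurableSet_siteEmbDomainCrossing _ _ _ _ _ _ ?_
  have h : {y : MixedSite | ((Real.sqrt 2 * δ : ℝ) : ℂ) * unionJackEmbed y ∈ R.carrier} =
      {y : MixedSite | (δ : ℂ) * zS y ∈ R.carrier} := by
    ext y
    simp only [Set.mem_setOf_eq, sqrt_two_mul_mul_unionJackEmbed]
  rw [h]
  exact cover_window_finite_zS R hδ

/-! ### The fixed-mesh squeeze and the limit -/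

/-- **The fixed-mesh squeeze.**  At a mesh `δ > 0` with `2δ ≤ κ` and `4δ ≤ ρ`, if the fattened bond event exceeds the
thinned collar-to-collar bond event in `P_{1/2}`-probability by at most `ε`, then the wide crude mixed crossing probability
at `q = 0` and the crude bond crossing probability of `R` differ by at most `ε` (both lie between `Pb[lower]` and
`Pb[upper]`; Kesten's coupling on the measurable wide event). [cite: Kesten1982, §3.4] -/
theorem wide_sandwich (R : ConformalRectangle) {κ ρ δ ε : ℝ} (hδ : 0 < δ) (hδκ : 2 * δ ≤ κ) (hδρ : 4 * δ ≤ ρ)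
    (hC : (bondPercolation (zdGraph 2) half).real (Freeze.upperCrossing R ρ δ) ≤
      (bondPercolation (zdGraph 2) half).real (Freeze.lowerCrossing R κ ρ δ) + ε) :
    (lawP 0).real {ω : Set MixedSite | ∃ u v, Metric.infDist ((δ : ℂ) * zS u) (R.arc 0) ≤ 2 * Real.sqrt 2 * δ ∧
        Metric.infDist ((δ : ℂ) * zS v) (R.arc 2) ≤ 2 * Real.sqrt 2 * δ ∧
        ω ∈ siteConnIn gsGraph {y | (δ : ℂ) * zS y ∈ R.carrier} u v} ≤ bondProb R δ + ε ∧
      bondProb R δ ≤ (lawP 0).real {ω : Set MixedSite | ∃ u v,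
        Metric.infDist ((δ : ℂ) * zS u) (R.arc 0) ≤ 2 * Real.sqrt 2 * δ ∧
        Metric.infDist ((δ : ℂ) * zS v) (R.arc 2) ≤ 2 * Real.sqrt 2 * δ ∧
        ω ∈ siteConnIn gsGraph {y | (δ : ℂ) * zS y ∈ R.carrier} u v} + ε := by
  set W : Set (Set MixedSite) := {ω : Set MixedSite | ∃ u v,
      Metric.infDist ((δ : ℂ) * zS u) (R.arc 0) ≤ 2 * Real.sqrt 2 * δ ∧
        Metric.infDist ((δ : ℂ) * zS v) (R.arc 2) ≤ 2 * Real.sqrt 2 * δ ∧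
        ω ∈ siteConnIn gsGraph {y | (δ : ℂ) * zS y ∈ R.carrier} u v} with hWdef
  have h2ρ : 2 * δ ≤ ρ := by linarith
  have h1ρ : δ ≤ ρ := by linarith
  have hρ0 : 0 ≤ ρ := by linarith
  have hδκ' : δ ≤ κ := by linarith
  have hsq : Real.sqrt 2 * δ ≤ κ := by
    have h2 : Real.sqrt 2 ≤ 2 := (Real.sqrt_le_left zero_le_two).2 (by norm_num)
    nlinarith
  have hae : ∀ᵐ η ∂ bondPercolation (zdGraph 2) half, η ⊆ (zdGraph 2).edgeSet :=
    ProbabilityTheory.setBernoulli_ae_subset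
  -- the crude bond event is below the fattened event
  have hcrU : bondProb R δ ≤ (bondPercolation (zdGraph 2) half).real (Freeze.upperCrossing R ρ δ) :=
    measureReal_mono (Freeze.embDomainCrossing_subset_upperCrossing R hδ.le h2ρ)
  -- the thinned event is below the crude bond event (a.s.)
  have hLcr : (bondPercolation (zdGraph 2) half).real (Freeze.lowerCrossing R κ ρ δ) ≤ bondProb R δ := by
    refine ENNReal.toReal_mono (measure_ne_top _ _) (measure_mono_ae ?_)
    filter_upwards [hae] with η hη hL
    exact Freeze.lowerCrossing_subset_embDomainCrossing R hδ hρ0 hsq hη hL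
  -- the thinned event is below the covering preimage of the wide event (a.s.)
  have hLpre : (bondPercolation (zdGraph 2) half).real (Freeze.lowerCrossing R κ ρ δ) ≤
      (bondPercolation (zdGraph 2) half).real (coverMap ⁻¹' W) := by
    refine ENNReal.toReal_mono (measure_ne_top _ _) (measure_mono_ae ?_)
    filter_upwards [hae] with η hη hL
    exact wide_lowerCrossing_subset_preimage R hδ hδκ' h1ρ hη hL
  -- the covering preimage is below the fattened event
  have hpreU : (bondPercolation (zdGraph 2) half).real (coverMap ⁻¹' W) ≤
      (bondPercolation (zdGraph 2) half).real (Freeze.upperCrossing R ρ δ) :=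
    measureReal_mono (wide_preimage_subset_upper R hδ hδρ)
  -- Kesten's coupling: the mixed probability IS the bond probability of the covering preimage
  have hpw : (lawP 0).real W = (bondPercolation (zdGraph 2) half).real (coverMap ⁻¹' W) :=
    cover_real_preimage (wide_measurableSet R hδ.ne')
  rw [hpw]
  constructor
  · linarith
  · linarith

/-- **`B'` — the wide-collar covering bridge (PROVED).**  For every conformal rectangle `R`,
`ujCrossingProb 0 R (√2·δ) − bondProb R δ → 0` as `δ → 0⁺`: the Union-Jack route's crude `P_{1/2,0}` crossing
probabilities (Kesten's encoding of bond-`ℤ²`, mesh `√2·δ`) and the crude bond-`ℤ²` crossing probabilities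
`embDomainCrossing squareLatticeEmbedding.z` (mesh `δ`, edge `√2·δ`) agree asymptotically.  Given `ε > 0`, the tree's
PROVED crude-crossing continuity for bond-`ℤ²` gives `κ, ρ > 0` with `Pb[upper] ≤ Pb[lower] + ε/2` for all small `δ`, and
`wide_sandwich` applies once moreover `δ < κ/2` and `δ < ρ/4`. [cite: SchrammSmirnov2011, Lemma 5.1] -/
theorem wide_tendsto_sub : ∀ R : Literature.Probability.RandomPlanarGeometry.ConformalRectangle, Filter.Tendsto (fun δ : ℝ => Literature.Probability.Percolation.ujCrossingProb 0 R (Real.sqrt 2 * δ) - Summit.CriticalPhenomena.CardyFormulaZ2.Cruxes.CoveringLeg.FiveArmNull.bondProb R δ) (nhdsWithin 0 (Set.Ioi 0)) (nhds 0) := by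
  intro R
  simp only [ujCrossingProb_sqrt_two_mul]
  rw [Metric.tendsto_nhds]
  intro ε hε
  obtain ⟨κ, hκ, ρ, hρ, hev⟩ :=
    stub_CrudeCrossingContinuity_of_SS QuadCrossing.SchrammSmirnov2011_lemma_5_1_holds R (ε / 2) (half_pos hε)
  have hδ₀ : (0 : ℝ) < min (κ / 2) (ρ / 4) := lt_min (half_pos hκ) (by positivity)
  filter_upwards [hev, Ioo_mem_nhdsGT hδ₀] with δ hC hδI
  have hδ : 0 < δ := hδI.1
  have hδκ : 2 * δ ≤ κ := by
    have h := lt_of_lt_of_le hδI.2 (min_le_left _ _)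
    linarith
  have hδρ : 4 * δ ≤ ρ := by
    have h := lt_of_lt_of_le hδI.2 (min_le_right _ _)
    linarith
  obtain ⟨h1, h2⟩ := wide_sandwich R hδ hδκ hδρ hC
  rw [Real.dist_0_eq_abs, abs_sub_lt_iff]
  constructor <;> linarith

/-! ### Consequences: the stub is stmt-4559 modulo the single site-side null; UnionJackBeffara's covering bridge -/

/-- **The stub IS stmt-4559 modulo the single SITE-side null `T'`** (explicit hypothesis; boundary RSW for critical
site percolation on `G_s`, not in the tree): `B'` of `stub_iff_unionJackBeffara_of_nulls` is `wide_tendsto_sub`.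
[cite: Beffara2008Universal, §5.1–5.2] -/
theorem stub_iff_unionJackBeffara_of_siteNull
    (hT' : ∀ R : ConformalRectangle, Tendsto (fun δ : ℝ => ujCrossingProb half R (Real.sqrt 2 * δ) -
      siteProb (R.map (similarity ((1 + Complex.I) / (Real.sqrt 2 : ℂ)) frame_rotInv_ne_zero 0)) δ)
      (𝓝[>] 0) (𝓝 0)) :
    Sig.stub_mixedInterpolationShift ↔ UnionJackBeffara.MixedInterpolation :=
  stub_iff_unionJackBeffara_of_nulls hT' wide_tendsto_sub

/-- **`CoveringLeg` ⟸ stmt-4559 modulo the single site-side null `T'`** (CONDITIONAL proof of the crux by name).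
[cite: Beffara2008Universal, §5.1–5.2] -/
theorem coveringLeg_of_unionJackBeffara_of_siteNull
    (hT' : ∀ R : ConformalRectangle, Tendsto (fun δ : ℝ => ujCrossingProb half R (Real.sqrt 2 * δ) -
      siteProb (R.map (similarity ((1 + Complex.I) / (Real.sqrt 2 : ℂ)) frame_rotInv_ne_zero 0)) δ)
      (𝓝[>] 0) (𝓝 0))
    (hM : UnionJackBeffara.MixedInterpolation) : CardyFlipRusso.CoveringLeg :=
  coveringLeg_of_mixedInterpolationShift ((stub_iff_unionJackBeffara_of_siteNull hT').2 hM)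

/-- `UnionJackBeffara.CoveringBridge` re-signed over `ujCrossingProb` (by `rfl`). [cite: Kesten1982, §3.4] -/
theorem unionJackBeffara_coveringBridge_iff :
    UnionJackBeffara.CoveringBridge ↔
      ((∀ R : ConformalRectangle, R.HasCrossingLimit (ujCrossingProb 0 R) cardyFunction) →
        ∀ R : ConformalRectangle, R.HasCrossingLimit (bondDomainCrossingProb R) cardyFunction) :=
  Iff.rfl

/-- **By-product for route UnionJackBeffara: its crux `CoveringBridge` (stmt-CriticalPhenomena-4560) follows from the
shared support item `DiscretisationBridge` (stmt-CriticalPhenomena-0787).**  Cardy for the Union-Jack crude `P_{1/2,0}`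
crossings, read at mesh `√2·δ` (`tendsto_comp_const_mul_iff`), is Cardy for the crude bond-`ℤ²` event by
`wide_tendsto_sub`; `DiscretisationBridge` turns that into Cardy for G02's `bondDomainCrossingProb`.
[cite: Kesten1982, §3.4] -/
theorem unionJackBeffara_coveringBridge_of_discretisationBridge (hD : CardyFlipRusso.DiscretisationBridge) :
    UnionJackBeffara.CoveringBridge := by
  rw [unionJackBeffara_coveringBridge_iff]
  intro h0 R
  refine hD R fun φ x hφ => ?_
  have h1 : Tendsto (fun δ : ℝ => ujCrossingProb 0 R (Real.sqrt 2 * δ)) (𝓝[>] 0)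
      (𝓝 (cardyFunction (crossRatio x))) :=
    (tendsto_comp_const_mul_iff (f := ujCrossingProb 0 R) (Real.sqrt_pos.2 two_pos)).2 (h0 R φ x hφ)
  have h2 := h1.sub (wide_tendsto_sub R)
  rw [sub_zero] at h2
  refine h2.congr' (Eventually.of_forall fun δ => ?_)
  simp only [sub_sub_cancel]
  rfl

end Summit.CriticalPhenomena.CardyFormulaZ2.Cruxes.CoveringLeg.FiveArmNull

end
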